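import Literature.AlgebraicTopology.CharacteristicClasses.LineCocycleEulerClass
import Literature.AlgebraicGeometry.HodgeTheory.LineBundleTopologicalChernClass
import HarnessLib

/-!
# Euler classes with arbitrary coefficients of the continuous cocycle of an algebraic line bundle on `X(ℂ)`

Family `hodge`, layer `Literature/AlgebraicGeometry/HodgeTheory`, namespace `Literature.AlgebraicGeometry.HodgeTheory` (dot-notation
extensions of ★ `Modules.UnitCocycle`).  THEOREMS ONLY (no definition, no named fact, no instance).  Companion of
★ `LineBundleTopologicalChernClass` (the INTEGRAL classes `UnitCocycle.topChernClass`, `CechPic.topChernClass`, `Modules.detTopChernClass`): the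
same invariances for the Euler classes `eulerClass ℂ c.complexCore.Fiber _ R m ∈ H²(X(ℂ); R)` of the continuous cocycle ★ `UnitCocycle.complexCore`
with ARBITRARY coefficients `R` (for `R = ℂ` these are the classes on the real carrier `H²(X(ℂ); ℂ) = complexBetti X 2` consumed by Hodge theory,
without a change of coefficients):

* `UnitCocycle.coreEulerClass_eq_of_coboundary` / `_of_equiv` / `_of_mk_eq` — cohomologous unit cocycles (Hartshorne III Ex. 4.5) have the same
  Euler classes (★ `coboundaryCore`, ★ `coreEulerClass_eq_of_refinement`, ★ `coreEulerClass_eq_of_cohomologous`);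
* `UnitCocycle.coreEulerClass_pullback` — NATURALITY `e(f^*c) = H²(f(ℂ)) e(c)` for every morphism `f : Y ⟶ X` of `ℂ`-schemes
  (★ `coreEulerClass_pullbackCore`, ★ `UnitCocycle.evalOrZero_gInf_pullback`);
* determinant cocycles of finite locally free modules (★ `Modules.detCocycle`): `coreEulerClass_detCocycle_eq_frameSystem` (any frame system,
  ★ `detClass_eq_mk`), `coreEulerClass_detCocycle_eq_of_iso` (★ `detClass_eq_of_iso`), `coreEulerClass_detCocycle_pullback` (★ `detClass_pullback`),
  `coreEulerClass_detCocycle_lineBundle` (★ `detClass_lineBundle`);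
* `coreEulerClass_toCore_cartierDivisorLineBundle` — junction with ★ `HolomorphicLineBundle.toCore` of `𝒪_X(D)^an` on an analytification `φ`.
* §5 `UnitCocycle.coreEulerClass_eq_map_of_mk_eq_pullback`, `Modules.coreEulerClass_eq_map_of_mk_eq_detClass_pow` / `_zpow` — the same
  naturality read through REPRESENTATIVES of classes `a`, `f^*a`, `[det E]^q`, `[det f^*E]^q` in `Ȟ¹(−, 𝒪^×)` (no additivity of `c₁` needed).

Cell pointer: `hodgecm-mathlib` (U)-lane, leaf (T2½) file (B) (the total-space → fibre step of the (N3-core) assembler in `ℂ`-coefficients).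
HC_CM is proved only modulo the 7 printed citations until rung 0 closes, and this file discharges none of them.

## References
* [Hartshorne1977] R. Hartshorne, *Algebraic Geometry* (1977), III Ex. 4.5, II Ex. 6.8 (a), II Ex. 6.11.
* [HusemollerFibreBundles1994] D. Husemoller, *Fibre Bundles*, 3rd ed. (1994), Ch. 5 §3 Thm. 3.2, Ch. 17 Prop. 3.3.
* [SerreGAGA1956] J.-P. Serre, GAGA, Ann. Inst. Fourier 6 (1956), §3 n°9, §4 n°20.
-/

set_option autoImplicit false

noncomputable section

open CategoryTheory AlgebraicGeometry TopologicalSpace Opposite Bundle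
open Literature.AlgebraicGeometry.Motives Literature.AlgebraicGeometry.Motives.AlgPoints
open Literature.AlgebraicGeometry.Modules
open Literature.AlgebraicTopology.CharacteristicClasses Literature.AlgebraicTopology.SingularHomology

namespace Literature.AlgebraicGeometry.HodgeTheory

/-! ### §1 Cohomologous unit cocycles -/

section Coboundary

variable {X : SchemeOver ℂ} {c c' : UnitCocycle X.left} (R : Type) [CommRing R]
  [T2Space (ComplexPoints X)] [ParacompactSpace (ComplexPoints X)]

/-- **Cohomologous unit cocycles have the same Euler classes, any coefficients** (Hartshorne III Ex. 4.5 read on `X(ℂ)`: restrict to the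
refinement `W_x`, rescale by the units `λ_x(P)`). [cite: Hartshorne1977, III Ex. 4.5] [cite: HusemollerFibreBundles1994, Ch. 5 §3 Thm. 3.2] -/
theorem _root_.Literature.AlgebraicGeometry.Modules.UnitCocycle.coreEulerClass_eq_of_coboundary (b : UnitCocycle.Coboundary c c') (m : R) :
    eulerClass ℂ c.complexCore.Fiber (Module.finrank_self ℂ) R m = eulerClass ℂ c'.complexCore.Fiber (Module.finrank_self ℂ) R m := by
  have h₁ : eulerClass ℂ (coboundaryCore b).Fiber (Module.finrank_self ℂ) R m = eulerClass ℂ c.complexCore.Fiber (Module.finrank_self ℂ) R m :=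
    coreEulerClass_eq_of_refinement (Z₁ := coboundaryCore b) (Z₂ := c.complexCore) (j := id) R (fun x _ hP ↦ b.le x hP)
      (fun _ _ _ _ ↦ rfl) m
  have h₂ : eulerClass ℂ (coboundaryCore b).Fiber (Module.finrank_self ℂ) R m =
      eulerClass ℂ c'.complexCore.Fiber (Module.finrank_self ℂ) R m :=
    coreEulerClass_eq_of_cohomologous (Z₁ := coboundaryCore b) (Z₂ := c'.complexCore) (j := id)
      (h := fun x P ↦ evalOrZero (b.W x) (b.lam x (b.W x) le_rfl) P) R (fun x _ hP ↦ b.le' x hP)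
      (fun x ↦ continuousOn_evalOrZero (b.W x) _) (fun x _ hP ↦ evalOrZero_lam_ne_zero b x hP)
      (fun x y P hP ↦ by
        rw [UnitCocycle.complexCore_coordChange_apply, mul_one]
        change _ = _ * (evalOrZero (c.U y ⊓ c.U x) (c.gInf y x) P * 1)
        rw [mul_one]
        exact evalOrZero_coboundary_rel b x y hP.1 hP.2) m
  rw [← h₁, h₂]

/-- Equivalent unit cocycles have the same Euler classes. [cite: Hartshorne1977, III Ex. 4.5] -/
theorem _root_.Literature.AlgebraicGeometry.Modules.UnitCocycle.coreEulerClass_eq_of_equiv (h : UnitCocycle.Equiv c c') (m : R) :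
    eulerClass ℂ c.complexCore.Fiber (Module.finrank_self ℂ) R m = eulerClass ℂ c'.complexCore.Fiber (Module.finrank_self ℂ) R m := by
  obtain ⟨b⟩ := h
  exact UnitCocycle.coreEulerClass_eq_of_coboundary R b m

/-- Unit cocycles with the same class in `Ȟ¹(X, 𝒪_X^×)` (★ `CechPic`) have the same Euler classes. [cite: Hartshorne1977, III Ex. 4.5] -/
theorem _root_.Literature.AlgebraicGeometry.Modules.UnitCocycle.coreEulerClass_eq_of_mk_eq (h : CechPic.mk c = CechPic.mk c') (m : R) :
    eulerClass ℂ c.complexCore.Fiber (Module.finrank_self ℂ) R m = eulerClass ℂ c'.complexCore.Fiber (Module.finrank_self ℂ) R m :=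
  UnitCocycle.coreEulerClass_eq_of_equiv R ((CechPic.mk_eq_mk_iff c c').1 h) m

end Coboundary

/-! ### §2 Naturality along any morphism of `ℂ`-schemes -/

section Pullback

variable {X Y : SchemeOver ℂ} (f : Y ⟶ X) (c : UnitCocycle X.left) (R : Type) [CommRing R]
  [T2Space (ComplexPoints X)] [ParacompactSpace (ComplexPoints X)] [T2Space (ComplexPoints Y)] [ParacompactSpace (ComplexPoints Y)]

/-- **`e(f^*c)(m) = H²(f(ℂ)) e(c)(m)`** for every morphism `f : Y ⟶ X` of `ℂ`-schemes, any coefficients: `f^♯ g` read at `Q` is `g` read at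
`f(Q)` (★ `UnitCocycle.evalOrZero_gInf_pullback`), a refinement along `y ↦ f y` of the induced cocycle (★ `coreEulerClass_eq_of_refinement`,
★ `coreEulerClass_pullbackCore`). [cite: HusemollerFibreBundles1994, Ch. 17 Prop. 3.3] [cite: Hartshorne1977, II Ex. 6.8 (a)] -/
theorem _root_.Literature.AlgebraicGeometry.Modules.UnitCocycle.coreEulerClass_pullback (m : R) :
    eulerClass ℂ (UnitCocycle.pullback f.left c).complexCore.Fiber (Module.finrank_self ℂ) R m =
      singularCohomology.map R R (AlgPoints.mapContinuous (L := ℂ) f) 2 (eulerClass ℂ c.complexCore.Fiber (Module.finrank_self ℂ) R m) := by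
  rw [← coreEulerClass_pullbackCore c.complexCore (AlgPoints.mapContinuous (L := ℂ) f) R m]
  refine coreEulerClass_eq_of_refinement (Z₁ := (UnitCocycle.pullback f.left c).complexCore)
    (Z₂ := c.complexCore.pullbackCore (AlgPoints.mapContinuous (L := ℂ) f)) (j := f.left.base) R (fun y Q hQ ↦ hQ) ?_ m
  intro y y' Q hQ
  rw [UnitCocycle.complexCore_coordChange_apply, VectorBundleCore.pullbackCore_coordChange, UnitCocycle.complexCore_coordChange_apply,
    AlgPoints.mapContinuous_apply]
  exact congrArg (· * (1 : ℂ)) (UnitCocycle.evalOrZero_gInf_pullback f c y' y hQ.2 hQ.1)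

end Pullback

/-! ### §3 Determinant cocycles of finite locally free modules -/

section Modules

variable {X Y : SchemeOver ℂ} [T2Space (ComplexPoints X)] [ParacompactSpace (ComplexPoints X)] {E E' : X.left.Modules}
  (R : Type) [CommRing R]

/-- **The Euler classes of the determinant cocycle can be computed in ANY frame system** (★ `detClass_eq_mk`). [cite: Hartshorne1977, III Ex. 4.5] -/
theorem _root_.Literature.AlgebraicGeometry.Modules.coreEulerClass_detCocycle_eq_frameSystem (hE : IsFiniteLocallyFree E) (F : FrameSystem E)
    (m : R) :
    eulerClass ℂ (detCocycle hE).complexCore.Fiber (Module.finrank_self ℂ) R m = eulerClass ℂ F.cocycle.complexCore.Fiber (Module.finrank_self ℂ) R m :=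
  UnitCocycle.coreEulerClass_eq_of_mk_eq R (detClass_eq_mk hE F) m

/-- **Isomorphic modules have the same Euler classes** (★ `detClass_eq_of_iso`). [cite: Hartshorne1977, III Ex. 4.5] -/
theorem _root_.Literature.AlgebraicGeometry.Modules.coreEulerClass_detCocycle_eq_of_iso (φ : E ≅ E') (hE : IsFiniteLocallyFree E)
    (hE' : IsFiniteLocallyFree E') (m : R) :
    eulerClass ℂ (detCocycle hE).complexCore.Fiber (Module.finrank_self ℂ) R m =
      eulerClass ℂ (detCocycle hE').complexCore.Fiber (Module.finrank_self ℂ) R m :=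
  UnitCocycle.coreEulerClass_eq_of_mk_eq R (detClass_eq_of_iso φ hE hE') m

/-- **The line bundle glued from `c` has the Euler classes of `c`** (★ `detClass_lineBundle`). [cite: Hartshorne1977, III Ex. 4.5] -/
theorem _root_.Literature.AlgebraicGeometry.Modules.coreEulerClass_detCocycle_lineBundle (c : UnitCocycle X.left) (m : R) :
    eulerClass ℂ (detCocycle c.isFiniteLocallyFree_lineBundle).complexCore.Fiber (Module.finrank_self ℂ) R m =
      eulerClass ℂ c.complexCore.Fiber (Module.finrank_self ℂ) R m :=
  UnitCocycle.coreEulerClass_eq_of_mk_eq R (UnitCocycle.detClass_lineBundle (c := c)) m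

variable [T2Space (ComplexPoints Y)] [ParacompactSpace (ComplexPoints Y)]

/-- **Naturality for modules: `e(det f^*E) = H²(f(ℂ)) e(det E)`** (★ `detClass_pullback`), any coefficients.
[cite: Hartshorne1977, II Ex. 6.8 (a)] [cite: HusemollerFibreBundles1994, Ch. 17 Prop. 3.3] -/
theorem _root_.Literature.AlgebraicGeometry.Modules.coreEulerClass_detCocycle_pullback (f : Y ⟶ X) (hE : IsFiniteLocallyFree E)
    (hE' : IsFiniteLocallyFree ((Scheme.Modules.pullback f.left).obj E)) (m : R) :
    eulerClass ℂ (detCocycle hE').complexCore.Fiber (Module.finrank_self ℂ) R m =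
      singularCohomology.map R R (AlgPoints.mapContinuous (L := ℂ) f) 2
        (eulerClass ℂ (detCocycle hE).complexCore.Fiber (Module.finrank_self ℂ) R m) := by
  have h : CechPic.mk (detCocycle hE') = CechPic.mk (UnitCocycle.pullback f.left (detCocycle hE)) := by
    change detClass hE' = _
    rw [detClass_congr hE' (hE.pullback f.left), detClass_pullback, detClass, CechPic.pullback_mk]
  rw [UnitCocycle.coreEulerClass_eq_of_mk_eq R h m, UnitCocycle.coreEulerClass_pullback]

end Modules

/-! ### §4 Junction with `𝒪_X(D)^an` on an analytification -/

section CartierJunction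

open scoped Manifold ContDiff
open Literature.Geometry.Kaehler Literature.NumberTheory.Transcendental

variable {X : SchemeOver ℂ} [IsIntegral X.left] {n : ℕ} {E : Type} [NormedAddCommGroup E] [NormedSpace ℂ E] [FiniteDimensional ℂ E]
  {M : Type} [TopologicalSpace M] [ChartedSpace E M] {φ : M → ComplexPoints X} (hφ : IsAnalytification E X n φ)
  (D : CartierDivisor X.left) (R : Type) [CommRing R]
  [T2Space M] [ParacompactSpace M] [T2Space (ComplexPoints X)] [ParacompactSpace (ComplexPoints X)]

/-- **`e((𝒪_X(D)^an).toCore)(m) = H²(φ) e(D.toUnitCocycle)(m)`** on an analytification `φ : M → X(ℂ)`, any coefficients (★ the `ℤ` case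
`lineChernClass_toCore_cartierDivisorLineBundle`). [cite: HusemollerFibreBundles1994, Ch. 17 Prop. 3.3] [cite: SerreGAGA1956, §3 n°9] -/
theorem coreEulerClass_toCore_cartierDivisorLineBundle (m : R) :
    eulerClass ℂ (cartierDivisorLineBundle hφ D).toCore.Fiber (Module.finrank_self ℂ) R m =
      singularCohomology.map R R (⟨φ, hφ.isHomeomorph.continuous⟩ : C(M, ComplexPoints X)) 2
        (eulerClass ℂ D.toUnitCocycle.complexCore.Fiber (Module.finrank_self ℂ) R m) := by
  rw [← coreEulerClass_pullbackCore D.toUnitCocycle.complexCore ⟨φ, hφ.isHomeomorph.continuous⟩ R m]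
  symm
  refine coreEulerClass_eq_of_refinement (Z₁ := D.toUnitCocycle.complexCore.pullbackCore ⟨φ, hφ.isHomeomorph.continuous⟩)
    (Z₂ := (cartierDivisorLineBundle hφ D).toCore) (j := D.chartIdx) R (fun x m hm ↦ hm) ?_ m
  intro x y m hm
  exact (cartierDivisorLineBundle_toCore_coordChange_eq hφ D x y hm).symm

end CartierJunction

/-! ### §5 Classes of `Ȟ¹(X, 𝒪_X^×)` read through representatives (powers included) -/

section Representatives

variable {X Y : SchemeOver ℂ} [T2Space (ComplexPoints X)] [ParacompactSpace (ComplexPoints X)]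
  [T2Space (ComplexPoints Y)] [ParacompactSpace (ComplexPoints Y)] (R : Type) [CommRing R] (f : Y ⟶ X)

/-- **Naturality read through representatives**: if `[c] = a` in `Ȟ¹(X, 𝒪_X^×)` and `[c'] = f^*a` in `Ȟ¹(Y, 𝒪_Y^×)`, then
`e(c')(m) = H²(f(ℂ)) e(c)(m)` (any coefficients). [cite: Hartshorne1977, III Ex. 4.5 and II Ex. 6.8 (a)] [cite: HusemollerFibreBundles1994, Ch. 17 Prop. 3.3] -/
theorem _root_.Literature.AlgebraicGeometry.Modules.UnitCocycle.coreEulerClass_eq_map_of_mk_eq_pullback {a : CechPic X.left}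
    {c : UnitCocycle X.left} {c' : UnitCocycle Y.left} (hc : CechPic.mk c = a) (hc' : CechPic.mk c' = CechPic.pullback f.left a) (m : R) :
    eulerClass ℂ c'.complexCore.Fiber (Module.finrank_self ℂ) R m =
      singularCohomology.map R R (AlgPoints.mapContinuous (L := ℂ) f) 2 (eulerClass ℂ c.complexCore.Fiber (Module.finrank_self ℂ) R m) := by
  rw [← UnitCocycle.coreEulerClass_pullback f c R m]
  exact UnitCocycle.coreEulerClass_eq_of_mk_eq R (by rw [hc', ← hc, CechPic.pullback_mk]) m

variable {E : X.left.Modules} (hE : IsFiniteLocallyFree E) (hE' : IsFiniteLocallyFree ((Scheme.Modules.pullback f.left).obj E))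

/-- **Powers of determinant classes read through representatives**: if `[c] = [det E]^q` and `[c'] = [det f^*E]^q` (`q : ℕ`), then
`e(c')(m) = H²(f(ℂ)) e(c)(m)` — no additivity of Chern classes is involved (★ `detClass_pullback`, `f^*` a group homomorphism).
[cite: Hartshorne1977, III Ex. 4.5 and II Ex. 6.8 (a)] [cite: HusemollerFibreBundles1994, Ch. 17 Prop. 3.3] -/
theorem _root_.Literature.AlgebraicGeometry.Modules.coreEulerClass_eq_map_of_mk_eq_detClass_pow (q : ℕ) {c : UnitCocycle X.left}
    {c' : UnitCocycle Y.left} (hc : CechPic.mk c = detClass hE ^ q) (hc' : CechPic.mk c' = detClass hE' ^ q) (m : R) :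
    eulerClass ℂ c'.complexCore.Fiber (Module.finrank_self ℂ) R m =
      singularCohomology.map R R (AlgPoints.mapContinuous (L := ℂ) f) 2 (eulerClass ℂ c.complexCore.Fiber (Module.finrank_self ℂ) R m) :=
  UnitCocycle.coreEulerClass_eq_map_of_mk_eq_pullback R f hc
    (by rw [hc', map_pow, detClass_congr hE' (hE.pullback f.left), detClass_pullback]) m

/-- The same for INTEGER powers `[det E]^n`, `n : ℤ` (duals and tensor powers). [cite: Hartshorne1977, III Ex. 4.5 and II Ex. 6.8 (a)] -/
theorem _root_.Literature.AlgebraicGeometry.Modules.coreEulerClass_eq_map_of_mk_eq_detClass_zpow (n : ℤ) {c : UnitCocycle X.left}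
    {c' : UnitCocycle Y.left} (hc : CechPic.mk c = detClass hE ^ n) (hc' : CechPic.mk c' = detClass hE' ^ n) (m : R) :
    eulerClass ℂ c'.complexCore.Fiber (Module.finrank_self ℂ) R m =
      singularCohomology.map R R (AlgPoints.mapContinuous (L := ℂ) f) 2 (eulerClass ℂ c.complexCore.Fiber (Module.finrank_self ℂ) R m) :=
  UnitCocycle.coreEulerClass_eq_map_of_mk_eq_pullback R f hc
    (by rw [hc', map_zpow, detClass_congr hE' (hE.pullback f.left), detClass_pullback]) m

end Representatives

end Literature.AlgebraicGeometry.HodgeTheory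

end
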